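import Summits.ABC.IUTFork.Conditional.AbcOfSHwindowFreyRefutationWindow
import Summits.ABC.IUTFork.Conditional.AbcOfSHwindowFreyRefutationApex
import Summits.ABC.IUTFork.Conditional.AbcOfSHwindowFreyRefutationAdmissible
import Summits.ABC.IUTFork.Conditional.AbcOfSGenuineKTameRobustRows3
import HarnessLib

/-!
# R-W task «C:HSHW-REF», tier 3, prime `p = 1061`: at the known abc triple `3³·241³ + 5⁸·11⁹·19·61³ = 2¹⁵·17²·331·1061⁴` and `l ∈ {13, 17, 19}`
# the binder `hSHwBad` of the cut certificate of record (p453137) is FALSE — modulo (P6) at the point, a named hypothesis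

PROOF-ONLY file (no `def`, no new `Prop`, no instance, no notation) of the abc-iut cell (seat abc-iut-W-ref-3, gen 0; R-W row «C:HSHW-REF tier-2/3»,
abc-iut-w6-d102's second, files disjoint by prime: THIS file is the prime `1061`; R-W numerics lead's rows `pilotDataOfK:frey-377933067-…:13`, `…:17`,
`…:19` of HOME/plan/rescue/R-W/TARGETS.tsv, kind TE (ranks 33/40 via `p = 1061`, 46 via `p = 241`), Szpiro margins −11.04 / −18.80 / −25.37). TAKES NO SIDE on [IUTchIII] Cor. 3.12 or on any author.

Inputs, all BY NAME: (S) ¬S_H at every genuine Θ-volume datum over `(ratPoint (a/c), l)`, `l ∈ {13, 17, 19}` — abc-iut-w5-d107's UNCONDITIONAL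
`GenuineK.not_pilotKummerCompatHull_chosen_triple_1061_thirteen` (p460892) / `…_seventeen` (p461351) / `…_nineteen` (p462317, via `e ∣ 30·l`); the dictionary of `j(a/c)` (§1:
`j = N / ∏_{p ∈ I} p^{e_p}`, `I = {2, 3, 5, 11, 17, 19, 61, 241, 331, 1061}`, `e = (22, 6, 16, 18, 4, 2, 6, 6, 2, 8)` = `2·v_p(abc)` at odd `p`,
`2·15 − 8` at `2`; abc-iut-c312-d1's `Corollary22RatPointDictionary`); admissibility §2 (`U_P`, `AdmitsCore`, (P2), (P5) — kit part 4); the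
Szpiro-bad guard §3 (kit part 1, integer certificates `A = 6, B = 9 / 8 / 8, n = 1`); window membership §4 (kit part 1 v2: every odd local height
is `≤ 18`, and `35·18 ≤ 754`, `63·18 ≤ 1258`, `80·18 ≤ 1558`); the apex §5 (kit part 3). (P6) = `Cor22.CondP6` at `(ratPoint (a/c), l)` is a HYPOTHESIS (an
existing definition, not decided in the tree at explicit points).

HONEST SCOPE: SHARP reading; per-label licence STRONGER than print; nothing about the printed GLOBAL inequality, the number-level Corollary
(`hNumBad`), the θ-cut record (p460293) or any author's intended hull; «refuted as typed» ≠ «refuted in print»; typed ≠ proved; instantiated ≠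
endorsed; no abc claim. [cite: Mochizuki2012, IUTchIII Cor. 3.12 p. 173–174, Step (xi-f) p. 184; IUTchIV Thm. 1.10 p. 22–23, Cor. 2.2 (ii) proof p. 44–46]
[cite: MochizukiGenEll2010, Def. 3.3 p. 12] [cite: DupuyHilado2025, §3.4] [claim: Mochizuki2012, status: disputed] for every IUT sentence quoted.
-/

noncomputable section

open Set Function NumberField IsDedekindDomain

namespace Summit.ABC.IUTFork.Conditional

open Thm311 Thm311.Real Cor312 Cor312Vol Cor312Prov Literature.IUT.LogThetaLattice Literature.IUT.LogVolume
  Literature.IUT.HodgeTheaters Literature.IUT.LogVolume.ThetaData Literature.IUT.LogVolume.Cor22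
open Literature.NumberTheory.NumberFields Literature.NumberTheory.GaloisRepresentations.Ultrametric
open Literature.NumberTheory.DiophantineGeometry Literature.NumberTheory.DiophantineGeometry.GenEll Summit.ABC.ABC.Theorems

namespace FreyRef

/-! ## §1. The dictionary of `j(a/c)`, `a/c = 3³·241³ / 2¹⁵·17²·331·1061⁴` -/

/-- **`j(a/c) = N/D`**, `N = (a² + ab + b²)³`, `D = (abc)²/2⁸ = 2²²·3⁶·5¹⁶·11¹⁸·17⁴·19²·61⁶·241⁶·331²·1061⁸` (the Frey formula `j = 2⁸(a²−ac+c²)³/(abc)²`,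
abc-iut-S6 `Cor22.jInv_ratPoint_triple`, evaluated). [cite: MochizukiGenEll2010, Def. 3.3 p. 12] -/
theorem frey1061_jInv : Cor22.jInv (((3 ^ 3 * 241 ^ 3 : ℕ) : ℚ) / (2 ^ 15 * 17 ^ 2 * 331 * 1061 ^ 4 : ℕ)) =
    ((3928473632788964672821551701672679333559417498513190808331340431518680900236702388736169384071395249577576315540261630773776368169 : ℕ) : ℚ) / ((138911770562511645706067751853331669754931704062616626765491158965741632102438816978560000000000000000 : ℕ) : ℚ) := by
  norm_num [Cor22.jInv]

/-- The primes of `I`. [folklore] -/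
theorem frey1061_primes : ∀ p ∈ ({2, 3, 5, 11, 17, 19, 61, 241, 331, 1061} : Finset ℕ), p.Prime := by
  intro p hp
  simp only [Finset.mem_insert, Finset.mem_singleton] at hp
  rcases hp with rfl | rfl | rfl | rfl | rfl | rfl | rfl | rfl | rfl | rfl <;> norm_num

/-- The exponents are `≥ 1`. [folklore] -/
theorem frey1061_exp_ne_zero : ∀ p ∈ ({2, 3, 5, 11, 17, 19, 61, 241, 331, 1061} : Finset ℕ),
    (fun p : ℕ => if p = 2 then 22 else if p = 5 then 16 else if p = 11 then 18 else if p = 17 then 4 else if p = 19 then 2 else if p = 331 then 2 else if p = 1061 then 8 else 6) p ≠ 0 := by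
  intro p _
  dsimp only
  split_ifs <;> decide

/-- `D = ∏_{p ∈ I} p^{e_p}`. [folklore] -/
theorem frey1061_D : (138911770562511645706067751853331669754931704062616626765491158965741632102438816978560000000000000000 : ℕ) =
    ∏ p ∈ ({2, 3, 5, 11, 17, 19, 61, 241, 331, 1061} : Finset ℕ), p ^ (fun p : ℕ => if p = 2 then 22 else if p = 5 then 16 else if p = 11 then 18 else if p = 17 then 4 else if p = 19 then 2 else if p = 331 then 2 else if p = 1061 then 8 else 6) p := by
  norm_num

/-- `p ∤ N` for `p ∈ I` (`a, b, c` pairwise coprime, `p ∣ abc ⇒ p ∤ a² + ab + b²`). [folklore] -/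
theorem frey1061_coprime : ∀ p ∈ ({2, 3, 5, 11, 17, 19, 61, 241, 331, 1061} : Finset ℕ),
    ¬ p ∣ (3928473632788964672821551701672679333559417498513190808331340431518680900236702388736169384071395249577576315540261630773776368169 : ℕ) := by
  intro p hp
  simp only [Finset.mem_insert, Finset.mem_singleton] at hp
  rcases hp with rfl | rfl | rfl | rfl | rfl | rfl | rfl | rfl | rfl | rfl <;> norm_num

/-- `N ≠ 0`. [folklore] -/
theorem frey1061_N_ne_zero : (3928473632788964672821551701672679333559417498513190808331340431518680900236702388736169384071395249577576315540261630773776368169 : ℕ) ≠ 0 := by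
  norm_num

/-! ## §2. Admissibility of `(ratPoint (a/c), l)`: `U_P`, `AdmitsCore`, (P2), (P5) -/

/-- `ratPoint (a/c) ∈ U_P`. [cite: MochizukiGenEll2010, Ex. 1.3 (i) p. 5] -/
theorem frey1061_mem_UP : ratPoint (((3 ^ 3 * 241 ^ 3 : ℕ) : ℚ) / (2 ^ 15 * 17 ^ 2 * 331 * 1061 ^ 4 : ℕ)) ∈ UP :=
  ratPoint_triple_mem_UP isABCTriple_1061

/-- **`AdmitsCore`**: `j(a/c)` is none of `2¹⁴31³/5³`, `2²73³/3⁴`, `1728`, `0` (its denominator carries `1061⁸`).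
[cite: Mochizuki2012, IUTchIV Cor. 2.2 (ii) proof p. 43] [claim: Mochizuki2012, status: disputed] -/
theorem frey1061_admitsCore : Cor22.AdmitsCore (ratPoint (((3 ^ 3 * 241 ^ 3 : ℕ) : ℚ) / (2 ^ 15 * 17 ^ 2 * 331 * 1061 ^ 4 : ℕ))) := by
  intro r hr
  change Cor22.jInv (((3 ^ 3 * 241 ^ 3 : ℕ) : ℚ) / (2 ^ 15 * 17 ^ 2 * 331 * 1061 ^ 4 : ℕ)) ≠ (r : ℚ)
  rw [frey1061_jInv]
  simp only [Cor22.coreExceptionalJ, Finset.mem_insert, Finset.mem_singleton] at hr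
  rcases hr with rfl | rfl | rfl | rfl <;> norm_num

/-- **(P2)** at `l ∈ {13, 17, 19}`: no exponent `e_p` is divisible by `13`, `17` or `19`. [cite: Mochizuki2012, IUTchIV Cor. 2.2 (ii) proof (P2) p. 45]
[claim: Mochizuki2012, status: disputed] -/
theorem frey1061_condP2 {l : ℕ} (hl : l = 13 ∨ l = 17 ∨ l = 19) : Cor22.CondP2 (ratPoint (((3 ^ 3 * 241 ^ 3 : ℕ) : ℚ) / (2 ^ 15 * 17 ^ 2 * 331 * 1061 ^ 4 : ℕ))) l := by
  refine condP2_ratPoint_of_dictionary frey1061_primes frey1061_exp_ne_zero frey1061_D frey1061_jInv frey1061_N_ne_zero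
    frey1061_coprime fun p hp => ?_
  simp only [Finset.mem_insert, Finset.mem_singleton] at hp
  rcases hl with rfl | rfl | rfl <;> rcases hp with rfl | rfl | rfl | rfl | rfl | rfl | rfl | rfl | rfl | rfl <;> norm_num

/-- **(P5)** at any prime `l ≠ 1061`: the place over `1061` is bad and divides neither `2` nor `l`. [cite: Mochizuki2012, IUTchIV Cor. 2.2 (ii) proof (P5) p. 46]
[claim: Mochizuki2012, status: disputed] -/
theorem frey1061_condP5 {l : ℕ} (hl : l.Prime) (hne : 1061 ≠ l) : Cor22.CondP5 (ratPoint (((3 ^ 3 * 241 ^ 3 : ℕ) : ℚ) / (2 ^ 15 * 17 ^ 2 * 331 * 1061 ^ 4 : ℕ))) l :=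
  condP5_ratPoint_of_dictionary frey1061_primes frey1061_exp_ne_zero frey1061_D frey1061_jInv frey1061_N_ne_zero frey1061_coprime
    hl (p₀ := 1061) (by simp) (by norm_num) hne

/-! ## §3. The Szpiro-bad guard at `l = 13`, `17`, `19` (integer certificates) -/

/-- **Szpiro-bad at `l = 13`**: `J = I ∖ {2, 13} = I ∖ {2}`, `A = 6`, `B = 9`, `n = 1`: `(∏_J p)⁶·63⁹ < (∏_J p^{e_p})·20⁹` (R-W margin −11.04).
[cite: Mochizuki2012, IUTchIV Thm. 1.10 p. 22–23] [claim: Mochizuki2012, status: disputed] -/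
theorem frey1061_szpiroBad_thirteen :
    ((13 : ℝ) + 5) / 4 < (Cor22.dmod (ratPoint (((3 ^ 3 * 241 ^ 3 : ℕ) : ℚ) / (2 ^ 15 * 17 ^ 2 * 331 * 1061 ^ 4 : ℕ))) : ℝ) ∨
      6 * (13 : ℕ) * (((13 : ℝ) + 5) - 4 * Cor22.dmod (ratPoint (((3 ^ 3 * 241 ^ 3 : ℕ) : ℚ) / (2 ^ 15 * 17 ^ 2 * 331 * 1061 ^ 4 : ℕ)))) / (((13 : ℝ) + 4) * ((13 : ℝ) - 3))
          * ((ratPoint (((3 ^ 3 * 241 ^ 3 : ℕ) : ℚ) / (2 ^ 15 * 17 ^ 2 * 331 * 1061 ^ 4 : ℕ))).logDiff + (1 - 1 / ((13 : ℕ) : ℝ)) * Cor22.logCondAvoid (ratPoint (((3 ^ 3 * 241 ^ 3 : ℕ) : ℚ) / (2 ^ 15 * 17 ^ 2 * 331 * 1061 ^ 4 : ℕ))) {2, 13})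
        + 6 * (13 : ℕ) * ((13 : ℝ) + 5) / (((13 : ℝ) + 4) * ((13 : ℝ) - 3)) * Real.log Real.pi
        < Cor22.logQAvoid (ratPoint (((3 ^ 3 * 241 ^ 3 : ℕ) : ℚ) / (2 ^ 15 * 17 ^ 2 * 331 * 1061 ^ 4 : ℕ))) {2, 13} :=
  szpiroBad_ratPoint_of_certificate frey1061_primes frey1061_exp_ne_zero frey1061_D frey1061_jInv frey1061_N_ne_zero (l := 13)
    (by norm_num) (fun p hp _ => frey1061_coprime p hp) {3, 5, 11, 17, 19, 61, 241, 331, 1061} (by decide) 6 9 1 (by norm_num)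
    (by norm_num) (by norm_num)
    (by norm_num)

/-- **Szpiro-bad at `l = 17`**: `J = I ∖ {2, 17}`, `A = 6`, `B = 8`, `n = 1` (R-W margin −18.80). [cite: Mochizuki2012, IUTchIV Thm. 1.10 p. 22–23]
[claim: Mochizuki2012, status: disputed] -/
theorem frey1061_szpiroBad_seventeen :
    ((17 : ℝ) + 5) / 4 < (Cor22.dmod (ratPoint (((3 ^ 3 * 241 ^ 3 : ℕ) : ℚ) / (2 ^ 15 * 17 ^ 2 * 331 * 1061 ^ 4 : ℕ))) : ℝ) ∨
      6 * (17 : ℕ) * (((17 : ℝ) + 5) - 4 * Cor22.dmod (ratPoint (((3 ^ 3 * 241 ^ 3 : ℕ) : ℚ) / (2 ^ 15 * 17 ^ 2 * 331 * 1061 ^ 4 : ℕ)))) / (((17 : ℝ) + 4) * ((17 : ℝ) - 3))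
          * ((ratPoint (((3 ^ 3 * 241 ^ 3 : ℕ) : ℚ) / (2 ^ 15 * 17 ^ 2 * 331 * 1061 ^ 4 : ℕ))).logDiff + (1 - 1 / ((17 : ℕ) : ℝ)) * Cor22.logCondAvoid (ratPoint (((3 ^ 3 * 241 ^ 3 : ℕ) : ℚ) / (2 ^ 15 * 17 ^ 2 * 331 * 1061 ^ 4 : ℕ))) {2, 17})
        + 6 * (17 : ℕ) * ((17 : ℝ) + 5) / (((17 : ℝ) + 4) * ((17 : ℝ) - 3)) * Real.log Real.pi
        < Cor22.logQAvoid (ratPoint (((3 ^ 3 * 241 ^ 3 : ℕ) : ℚ) / (2 ^ 15 * 17 ^ 2 * 331 * 1061 ^ 4 : ℕ))) {2, 17} :=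
  szpiroBad_ratPoint_of_certificate frey1061_primes frey1061_exp_ne_zero frey1061_D frey1061_jInv frey1061_N_ne_zero (l := 17)
    (by norm_num) (fun p hp _ => frey1061_coprime p hp) {3, 5, 11, 19, 61, 241, 331, 1061} (by decide) 6 8 1 (by norm_num)
    (by norm_num) (by norm_num)
    (by norm_num)

/-- **Szpiro-bad at `l = 19`**: `J = I ∖ {2, 19}`, `A = 6`, `B = 8`, `n = 1` (R-W margin −25.37). [cite: Mochizuki2012, IUTchIV Thm. 1.10 p. 22–23]
[claim: Mochizuki2012, status: disputed] -/
theorem frey1061_szpiroBad_nineteen :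
    ((19 : ℝ) + 5) / 4 < (Cor22.dmod (ratPoint (((3 ^ 3 * 241 ^ 3 : ℕ) : ℚ) / (2 ^ 15 * 17 ^ 2 * 331 * 1061 ^ 4 : ℕ))) : ℝ) ∨
      6 * (19 : ℕ) * (((19 : ℝ) + 5) - 4 * Cor22.dmod (ratPoint (((3 ^ 3 * 241 ^ 3 : ℕ) : ℚ) / (2 ^ 15 * 17 ^ 2 * 331 * 1061 ^ 4 : ℕ)))) / (((19 : ℝ) + 4) * ((19 : ℝ) - 3))
          * ((ratPoint (((3 ^ 3 * 241 ^ 3 : ℕ) : ℚ) / (2 ^ 15 * 17 ^ 2 * 331 * 1061 ^ 4 : ℕ))).logDiff + (1 - 1 / ((19 : ℕ) : ℝ)) * Cor22.logCondAvoid (ratPoint (((3 ^ 3 * 241 ^ 3 : ℕ) : ℚ) / (2 ^ 15 * 17 ^ 2 * 331 * 1061 ^ 4 : ℕ))) {2, 19})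
        + 6 * (19 : ℕ) * ((19 : ℝ) + 5) / (((19 : ℝ) + 4) * ((19 : ℝ) - 3)) * Real.log Real.pi
        < Cor22.logQAvoid (ratPoint (((3 ^ 3 * 241 ^ 3 : ℕ) : ℚ) / (2 ^ 15 * 17 ^ 2 * 331 * 1061 ^ 4 : ℕ))) {2, 19} :=
  szpiroBad_ratPoint_of_certificate frey1061_primes frey1061_exp_ne_zero frey1061_D frey1061_jInv frey1061_N_ne_zero (l := 19)
    (by norm_num) (fun p hp _ => frey1061_coprime p hp) {3, 5, 11, 17, 61, 241, 331, 1061} (by decide) 6 8 1 (by norm_num)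
    (by norm_num) (by norm_num)
    (by norm_num)

/-! ## §4. Window membership: every datum over `(ratPoint (a/c), l)`, `l ∈ {13, 17, 19}`, is off the degree-form depth locus -/

/-- **In the window at `l ∈ {13, 17, 19}`**: every odd local height of `a/c` is `≤ 18` and `((l⋆)²−1)·18 ≤ 2l·(4(l⋆+1)+1)` (`630 ≤ 754`, `1134 ≤ 1258`,
`1440 ≤ 1558`),
so the depth antecedent of `hSHwBad` holds at EVERY genuine Θ-volume datum `T` over the point (kit `FreyRef.not_deep_ratPoint`).
[cite: Mochizuki2012, IUTchIV Thm. 1.10 p. 22–23] [claim: Mochizuki2012, status: disputed] -/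
theorem frey1061_not_deep {l : ℕ} (hl : l = 13 ∨ l = 17 ∨ l = 19) (T : Cor22.ThetaVolumeDatumAt (ratPoint (((3 ^ 3 * 241 ^ 3 : ℕ) : ℚ) / (2 ^ 15 * 17 ^ 2 * 331 * 1061 ^ 4 : ℕ))) l) :
    letI := T.instFieldF; letI := T.instNumberFieldF; letI := T.instAlgebraF; letI := T.instFieldK
    letI := T.instNumberFieldK; letI := T.instAlgebraK; letI := T.instFieldFbar; letI := T.instAlgebraFbar
    letI := T.instAlgebraKFbar; letI := T.instIsElliptic
    ¬ (∃ (pp : Nat.Primes) (_ : 2 < (pp : ℕ)) (i : Fin (thetaIndex (pilotDataOfK T.D T.K)).lstar)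
        (x₀ : (thetaIndex (pilotDataOfK T.D T.K)).Fibre (.inr pp)),
      haveI : Fact (pp : ℕ).Prime := ⟨pp.2⟩
      ((pp : ℕ) : ℝ) ^ ((((i : ℕ) : ℝ) + 2) * (4 + 2 * Real.logb (pp : ℕ) (Module.finrank ℚ T.K)) + 1) *
        ‖(exists_realising_qIdeles_pilotDataOfK T.D).choose pp x₀‖ ^ (((i : ℕ) + 1) ^ 2 - 1) < 1) := by
  refine not_deep_ratPoint T fun u hu2 hneg => ?_
  have hmem := (Cor22.ord_jInv_ratPoint_neg_iff frey1061_primes frey1061_exp_ne_zero frey1061_D frey1061_jInv frey1061_N_ne_zero u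
    (fun h => frey1061_coprime _ h)).1 hneg
  rw [Cor22.ord_jInv_ratPoint_of_mem frey1061_primes frey1061_D frey1061_jInv frey1061_N_ne_zero u hmem (frey1061_coprime _ hmem)]
  push_cast
  simp only [neg_neg]
  have hp1 : 1 < Rat.HeightOneSpectrum.natGenerator u := (Rat.HeightOneSpectrum.prime_natGenerator u).one_lt
  -- every ODD local height is `≤ 18`, and `((l⋆)²−1)·18 ≤ 2l·(4(l⋆+1)+1)` at `l ∈ {13, 17, 19}`
  refine topLabel_test_of_le (B := 18) hp1 (by rcases hl with rfl | rfl | rfl <;> norm_num) ?_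
    (by rcases hl with rfl | rfl | rfl <;> norm_num)
  simp only [Finset.mem_insert, Finset.mem_singleton] at hmem
  generalize Rat.HeightOneSpectrum.natGenerator u = p at hmem hu2 ⊢
  rcases hmem with rfl | rfl | rfl | rfl | rfl | rfl | rfl | rfl | rfl | rfl
  · exact absurd hu2 (by norm_num)
  all_goals norm_num

/-! ## §5. The APEX at `p = 1061`: `hSHwBad` of p453137 is FALSE (modulo (P6) at the point) -/

/-- **APEX, `p = 1061`, `l₀ ∈ {13, 17, 19}`.** ASSUMING (P6) = `Cor22.CondP6` at `(ratPoint (3³·241³/2¹⁵·17²·331·1061⁴), l₀)` (the image of Galois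
on `E[l₀]` over the theta field; NOT decided here), the binder `hSHwBad` of the cut certificate of record `Conditional.abc_of_SH_v10K_window_szpiroBadAll`
(abc-iut-s2-p2 p453137; VERBATIM its text) is FALSE for EVERY family of the certificate's free context binders: the point is admissible (§2) and
Szpiro-bad (§3), every genuine Θ-volume datum over it is in the window (§4) and violates S_H (abc-iut-w5-d107 p460892 / p461351 / p462317), and a datum
exists (`ThetaPartII.stub_thetaData`). Refuted-as-typed ≠ refuted-in-print; says nothing about [IUTchIII] Cor. 3.12, `hNumBad`, the θ-cut record
or abc. [cite: Mochizuki2012, IUTchIII Cor. 3.12 p. 173–174; IUTchIV Cor. 2.2 (ii) proof (P6)(P7) p. 46] [claim: Mochizuki2012, status: disputed] -/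
theorem not_hSHwBad_frey_1061 {l₀ : ℕ} (hl₀ : l₀ = 13 ∨ l₀ = 17 ∨ l₀ = 19)
    (hP6 : Cor22.CondP6 (ratPoint (((3 ^ 3 * 241 ^ 3 : ℕ) : ℚ) / (2 ^ 15 * 17 ^ 2 * 331 * 1061 ^ 4 : ℕ))) l₀)
    (M : ∀ (P : NFPoint) (l : ℕ) (T : Cor22.ThetaVolumeDatumAt P l), Type) [∀ P l T, Field (M P l T)] [∀ P l T, NumberField (M P l T)]
    (archPk : ∀ (P : NFPoint) (l : ℕ) (T : Cor22.ThetaVolumeDatumAt P l), letI := T.instFieldF; letI := T.instNumberFieldF; letI := T.instAlgebraF; letI := T.instFieldK;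
        letI := T.instNumberFieldK; letI := T.instAlgebraK; letI := T.instFieldFbar; letI := T.instAlgebraFbar;
        letI := T.instAlgebraKFbar; letI := T.instIsElliptic;
      ∀ (j : (thetaIndex (pilotDataOfK T.D T.K)).Label) (vQ : (thetaIndex (pilotDataOfK T.D T.K)).VQ), Set ((logShellsDH (pilotDataOfK T.D T.K) (analyticLogv T.K)).Packet j vQ))
    (archSub : ∀ (P : NFPoint) (l : ℕ) (T : Cor22.ThetaVolumeDatumAt P l), letI := T.instFieldF; letI := T.instNumberFieldF; letI := T.instAlgebraF; letI := T.instFieldK;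
        letI := T.instNumberFieldK; letI := T.instAlgebraK; letI := T.instFieldFbar; letI := T.instAlgebraFbar;
        letI := T.instAlgebraKFbar; letI := T.instIsElliptic;
      ∀ (j : (thetaIndex (pilotDataOfK T.D T.K)).Label) (v : (thetaIndex (pilotDataOfK T.D T.K)).V), Set ((logShellsDH (pilotDataOfK T.D T.K) (analyticLogv T.K)).Packet j ((thetaIndex (pilotDataOfK T.D T.K)).over v)))
    (Ψ : ∀ (P : NFPoint) (l : ℕ) (T : Cor22.ThetaVolumeDatumAt P l), letI := T.instFieldF; letI := T.instNumberFieldF; letI := T.instAlgebraF; letI := T.instFieldK;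
        letI := T.instNumberFieldK; letI := T.instAlgebraK; letI := T.instFieldFbar; letI := T.instAlgebraFbar;
        letI := T.instAlgebraKFbar; letI := T.instIsElliptic;
      ℤ → ∀ v : (thetaIndex (pilotDataOfK T.D T.K)).V, v ∈ (thetaIndex (pilotDataOfK T.D T.K)).Vbad → Set ((logShellsDH (pilotDataOfK T.D T.K) (analyticLogv T.K)).StarPacket v))
    (act : ∀ (P : NFPoint) (l : ℕ) (T : Cor22.ThetaVolumeDatumAt P l), letI := T.instFieldF; letI := T.instNumberFieldF; letI := T.instAlgebraF; letI := T.instFieldK;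
        letI := T.instNumberFieldK; letI := T.instAlgebraK; letI := T.instFieldFbar; letI := T.instAlgebraFbar;
        letI := T.instAlgebraKFbar; letI := T.instIsElliptic;
      ℤ → ∀ v : (thetaIndex (pilotDataOfK T.D T.K)).V, v ∈ (thetaIndex (pilotDataOfK T.D T.K)).Vbad → (logShellsDH (pilotDataOfK T.D T.K) (analyticLogv T.K)).StarPacket v → Module.End ℚ ((logShellsDH (pilotDataOfK T.D T.K) (analyticLogv T.K)).StarPacket v))
    (Mmod : ∀ (P : NFPoint) (l : ℕ) (T : Cor22.ThetaVolumeDatumAt P l), letI := T.instFieldF; letI := T.instNumberFieldF; letI := T.instAlgebraF; letI := T.instFieldK;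
        letI := T.instNumberFieldK; letI := T.instAlgebraK; letI := T.instFieldFbar; letI := T.instAlgebraFbar;
        letI := T.instAlgebraKFbar; letI := T.instIsElliptic;
      ℤ → ∀ j : (thetaIndex (pilotDataOfK T.D T.K)).LabelStar, Set ((logShellsDH (pilotDataOfK T.D T.K) (analyticLogv T.K)).GlobalPacket j.1))
    (region : ∀ (P : NFPoint) (l : ℕ) (T : Cor22.ThetaVolumeDatumAt P l), letI := T.instFieldF; letI := T.instNumberFieldF; letI := T.instAlgebraF; letI := T.instFieldK;
        letI := T.instNumberFieldK; letI := T.instAlgebraK; letI := T.instFieldFbar; letI := T.instAlgebraFbar;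
        letI := T.instAlgebraKFbar; letI := T.instIsElliptic;
      ℤ → ∀ j : (thetaIndex (pilotDataOfK T.D T.K)).LabelStar, FinDivisor (M P l T) → ∀ vQ : (thetaIndex (pilotDataOfK T.D T.K)).VQ, Set ((logShellsDH (pilotDataOfK T.D T.K) (analyticLogv T.K)).Packet j.1 vQ))
    (frobAdm : ∀ (P : NFPoint) (l : ℕ) (T : Cor22.ThetaVolumeDatumAt P l), letI := T.instFieldF; letI := T.instNumberFieldF; letI := T.instAlgebraF; letI := T.instFieldK;
        letI := T.instNumberFieldK; letI := T.instAlgebraK; letI := T.instFieldFbar; letI := T.instAlgebraFbar;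
        letI := T.instAlgebraKFbar; letI := T.instIsElliptic;
      ℤ → ℤ → ∀ (j : (thetaIndex (pilotDataOfK T.D T.K)).Label) (vQ : (thetaIndex (pilotDataOfK T.D T.K)).VQ), Set ((logShellsDH (pilotDataOfK T.D T.K) (analyticLogv T.K)).Packet j vQ) → Prop)
    (frobLogvol : ∀ (P : NFPoint) (l : ℕ) (T : Cor22.ThetaVolumeDatumAt P l), letI := T.instFieldF; letI := T.instNumberFieldF; letI := T.instAlgebraF; letI := T.instFieldK;
        letI := T.instNumberFieldK; letI := T.instAlgebraK; letI := T.instFieldFbar; letI := T.instAlgebraFbar;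
        letI := T.instAlgebraKFbar; letI := T.instIsElliptic;
      ℤ → ℤ → ∀ (j : (thetaIndex (pilotDataOfK T.D T.K)).Label) (vQ : (thetaIndex (pilotDataOfK T.D T.K)).VQ), Set ((logShellsDH (pilotDataOfK T.D T.K) (analyticLogv T.K)).Packet j vQ) → ℝ)
    (frobΨ : ∀ (P : NFPoint) (l : ℕ) (T : Cor22.ThetaVolumeDatumAt P l), letI := T.instFieldF; letI := T.instNumberFieldF; letI := T.instAlgebraF; letI := T.instFieldK;
        letI := T.instNumberFieldK; letI := T.instAlgebraK; letI := T.instFieldFbar; letI := T.instAlgebraFbar;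
        letI := T.instAlgebraKFbar; letI := T.instIsElliptic;
      ℤ → ℤ → ∀ v : (thetaIndex (pilotDataOfK T.D T.K)).V, v ∈ (thetaIndex (pilotDataOfK T.D T.K)).Vbad → Set ((logShellsDH (pilotDataOfK T.D T.K) (analyticLogv T.K)).StarPacket v))
    (frobMmod : ∀ (P : NFPoint) (l : ℕ) (T : Cor22.ThetaVolumeDatumAt P l), letI := T.instFieldF; letI := T.instNumberFieldF; letI := T.instAlgebraF; letI := T.instFieldK;
        letI := T.instNumberFieldK; letI := T.instAlgebraK; letI := T.instFieldFbar; letI := T.instAlgebraFbar;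
        letI := T.instAlgebraKFbar; letI := T.instIsElliptic;
      ℤ → ℤ → ∀ j : (thetaIndex (pilotDataOfK T.D T.K)).LabelStar, Set ((logShellsDH (pilotDataOfK T.D T.K) (analyticLogv T.K)).GlobalPacket j.1))
    (unitImage : ∀ (P : NFPoint) (l : ℕ) (T : Cor22.ThetaVolumeDatumAt P l), letI := T.instFieldF; letI := T.instNumberFieldF; letI := T.instAlgebraF; letI := T.instFieldK;
        letI := T.instNumberFieldK; letI := T.instAlgebraK; letI := T.instFieldFbar; letI := T.instAlgebraFbar;
        letI := T.instAlgebraKFbar; letI := T.instIsElliptic;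
      ℤ → ℤ → ℕ → ∀ (j : (thetaIndex (pilotDataOfK T.D T.K)).Label) (vQ : (thetaIndex (pilotDataOfK T.D T.K)).VQ), Set ((logShellsDH (pilotDataOfK T.D T.K) (analyticLogv T.K)).Packet j vQ))
    (ballImage : ∀ (P : NFPoint) (l : ℕ) (T : Cor22.ThetaVolumeDatumAt P l), letI := T.instFieldF; letI := T.instNumberFieldF; letI := T.instAlgebraF; letI := T.instFieldK;
        letI := T.instNumberFieldK; letI := T.instAlgebraK; letI := T.instFieldFbar; letI := T.instAlgebraFbar;
        letI := T.instAlgebraKFbar; letI := T.instIsElliptic;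
      ℤ → ℤ → ∀ (j : (thetaIndex (pilotDataOfK T.D T.K)).Label) (vQ : (thetaIndex (pilotDataOfK T.D T.K)).VQ), Set ((logShellsDH (pilotDataOfK T.D T.K) (analyticLogv T.K)).Packet j vQ))
    (thetaDiv : ∀ (P : NFPoint) (l : ℕ) (T : Cor22.ThetaVolumeDatumAt P l), letI := T.instFieldF; letI := T.instNumberFieldF; letI := T.instAlgebraF; letI := T.instFieldK;
        letI := T.instNumberFieldK; letI := T.instAlgebraK; letI := T.instFieldFbar; letI := T.instAlgebraFbar;
        letI := T.instAlgebraKFbar; letI := T.instIsElliptic;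
      ℤ → ℤ → LgpDivisor (M P l T) (thetaIndex (pilotDataOfK T.D T.K)).lstar)
    (n : ∀ (P : NFPoint) (l : ℕ) (T : Cor22.ThetaVolumeDatumAt P l), ℤ)
    {HT : ∀ (P : NFPoint) (l : ℕ) (T : Cor22.ThetaVolumeDatumAt P l), Type} {LogLink : ∀ (P : NFPoint) (l : ℕ) (T : Cor22.ThetaVolumeDatumAt P l), HT P l T → HT P l T → Type}
    {IsFull : ∀ (P : NFPoint) (l : ℕ) (T : Cor22.ThetaVolumeDatumAt P l), ∀ {s t : HT P l T}, LogLink P l T s t → Prop}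
    (lat : ∀ (P : NFPoint) (l : ℕ) (T : Cor22.ThetaVolumeDatumAt P l), LGPGaussianLogThetaLattice (LogLink P l T) (IsFull P l T))
    {Frd : ∀ (P : NFPoint) (l : ℕ) (T : Cor22.ThetaVolumeDatumAt P l), Type} {IsoF : ∀ (P : NFPoint) (l : ℕ) (T : Cor22.ThetaVolumeDatumAt P l), Frd P l T → Frd P l T → Type} {Ob : ∀ (P : NFPoint) (l : ℕ) (T : Cor22.ThetaVolumeDatumAt P l), Frd P l T → Type}
    {realify : ∀ (P : NFPoint) (l : ℕ) (T : Cor22.ThetaVolumeDatumAt P l), Frd P l T → Frd P l T} {Strip : ∀ (P : NFPoint) (l : ℕ) (T : Cor22.ThetaVolumeDatumAt P l), Type} {IsoS : ∀ (P : NFPoint) (l : ℕ) (T : Cor22.ThetaVolumeDatumAt P l), Strip P l T → Strip P l T → Type}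
    {Mv : ∀ (P : NFPoint) (l : ℕ) (T : Cor22.ThetaVolumeDatumAt P l), letI := T.instFieldF; letI := T.instNumberFieldF; letI := T.instAlgebraF; letI := T.instFieldK;
        letI := T.instNumberFieldK; letI := T.instAlgebraK; letI := T.instFieldFbar; letI := T.instAlgebraFbar;
        letI := T.instAlgebraKFbar; letI := T.instIsElliptic;
      ∀ v : (thetaIndex (pilotDataOfK T.D T.K)).V, v ∈ (thetaIndex (pilotDataOfK T.D T.K)).Vbad → Type}
    [∀ P l T v h, Monoid (Mv P l T v h)]
    (sig : ∀ (P : NFPoint) (l : ℕ) (T : Cor22.ThetaVolumeDatumAt P l), letI := T.instFieldF; letI := T.instNumberFieldF; letI := T.instAlgebraF; letI := T.instFieldK;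
        letI := T.instNumberFieldK; letI := T.instAlgebraK; letI := T.instFieldFbar; letI := T.instAlgebraFbar;
        letI := T.instAlgebraKFbar; letI := T.instIsElliptic;
      GlobalLGPFrobenioidSignature (thetaIndex (pilotDataOfK T.D T.K)).lstar (thetaIndex (pilotDataOfK T.D T.K)).V (· ∈ (thetaIndex (pilotDataOfK T.D T.K)).Vbad) (Frd P l T) (IsoF P l T) (Ob P l T) (realify P l T)
        (Strip P l T) (IsoS P l T) (Mv P l T))
    (split : ∀ (P : NFPoint) (l : ℕ) (T : Cor22.ThetaVolumeDatumAt P l), SplittingMonoids (Mv P l T))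
    {ObΔ : ∀ (P : NFPoint) (l : ℕ) (T : Cor22.ThetaVolumeDatumAt P l), Type} {N : ∀ (P : NFPoint) (l : ℕ) (T : Cor22.ThetaVolumeDatumAt P l), letI := T.instFieldF; letI := T.instNumberFieldF; letI := T.instAlgebraF; letI := T.instFieldK;
        letI := T.instNumberFieldK; letI := T.instAlgebraK; letI := T.instFieldFbar; letI := T.instAlgebraFbar;
        letI := T.instAlgebraKFbar; letI := T.instIsElliptic;
      ∀ v : (thetaIndex (pilotDataOfK T.D T.K)).V, v ∈ (thetaIndex (pilotDataOfK T.D T.K)).Vbad → Type}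
    [∀ P l T v h, Monoid (N P l T v h)] (qData : ∀ (P : NFPoint) (l : ℕ) (T : Cor22.ThetaVolumeDatumAt P l), QPilotData (ObΔ P l T) (N P l T))
    (qK : ∀ (P : NFPoint) (l : ℕ) (T : Cor22.ThetaVolumeDatumAt P l), letI := T.instFieldF; letI := T.instNumberFieldF; letI := T.instAlgebraF; letI := T.instFieldK;
        letI := T.instNumberFieldK; letI := T.instAlgebraK; letI := T.instFieldFbar; letI := T.instAlgebraFbar;
        letI := T.instAlgebraKFbar; letI := T.instIsElliptic;
      ∀ v : (thetaIndex (pilotDataOfK T.D T.K)).V, v ∈ (thetaIndex (pilotDataOfK T.D T.K)).Vbad → Set ((logShellsDH (pilotDataOfK T.D T.K) (analyticLogv T.K)).StarPacket v)) :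
    ¬ (∀ (P : NFPoint), P ∈ UP → ∀ (l : ℕ), l.Prime → 5 ≤ l →
      Cor22.AdmitsCore P → Cor22.CondP2 P l → Cor22.CondP5 P l → Cor22.CondP6 P l →
      -- ONLY at SZPIRO-BAD `(P, l)`: elsewhere `T.Cor312Of` is the theorem `Cor22.ThetaVolumeDatumAt.cor312Of_of_szpiro` (abc-iut-c312-d1)
      (((l : ℝ) + 5) / 4 < (Cor22.dmod P : ℝ) ∨
        6 * l * (((l : ℝ) + 5) - 4 * Cor22.dmod P) / (((l : ℝ) + 4) * ((l : ℝ) - 3))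
            * (P.logDiff + (1 - 1 / (l : ℝ)) * Cor22.logCondAvoid P {2, l})
          + 6 * l * ((l : ℝ) + 5) / (((l : ℝ) + 4) * ((l : ℝ) - 3)) * Real.log Real.pi < Cor22.logQAvoid P {2, l}) →
      ∀ (T : Cor22.ThetaVolumeDatumAt P l), letI := T.instFieldF; letI := T.instNumberFieldF; letI := T.instAlgebraF; letI := T.instFieldK;
        letI := T.instNumberFieldK; letI := T.instAlgebraK; letI := T.instFieldFbar; letI := T.instAlgebraFbar;
        letI := T.instAlgebraKFbar; letI := T.instIsElliptic;
      ¬ (∃ (pp : Nat.Primes) (_ : 2 < (pp : ℕ)) (i : Fin (thetaIndex (pilotDataOfK T.D T.K)).lstar)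
          (x₀ : (thetaIndex (pilotDataOfK T.D T.K)).Fibre (.inr pp)),
        haveI : Fact (pp : ℕ).Prime := ⟨pp.2⟩
        ((pp : ℕ) : ℝ) ^ ((((i : ℕ) : ℝ) + 2) * (4 + 2 * Real.logb (pp : ℕ) (Module.finrank ℚ T.K)) + 1) *
          ‖(exists_realising_qIdeles_pilotDataOfK T.D).choose pp x₀‖ ^ (((i : ℕ) + 1) ^ 2 - 1) < 1) →
      Cor312Vol.PilotKummerCompatHull
        (LatticeSituation.ofShells (logShellsDH (pilotDataOfK T.D T.K) (analyticLogv T.K)) (M P l T) (archPk P l T)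
          (archSub P l T) (summandPiecesPr (pilotDataOfK T.D T.K) (logvAnalytic_analyticLogv (F := T.K))).Adm
          (summandPiecesPr (pilotDataOfK T.D T.K) (logvAnalytic_analyticLogv (F := T.K))).logvol (Ψ P l T) (act P l T) (Mmod P l T)
          (region P l T) (frobAdm P l T) (frobLogvol P l T) (frobΨ P l T) (frobMmod P l T) (unitImage P l T)
          (ballImage P l T) (thetaDiv P l T))
        (settingPrVolSharp (pilotDataOfK T.D T.K) (logvAnalytic_analyticLogv (F := T.K)) (M P l T) (archPk P l T) (archSub P l T) (Ψ P l T)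
          (act P l T) (Mmod P l T) (region P l T) (n P l T) (lat P l T) (sig P l T) (split P l T) (qData P l T)
          (exists_realising_qIdeles_pilotDataOfK T.D).choose
          (exists_realising_thetaIdeles_pilotDataOfK T.D).choose
          (exists_realising_qIdeles_pilotDataOfK T.D).choose_spec.1
          (exists_realising_qIdeles_pilotDataOfK T.D).choose_spec.2.1)
        (fun _ => Cor312.Setting.qRegion
        (settingPrVolSharp (pilotDataOfK T.D T.K) (logvAnalytic_analyticLogv (F := T.K)) (M P l T) (archPk P l T) (archSub P l T) (Ψ P l T)
          (act P l T) (Mmod P l T) (region P l T) (n P l T) (lat P l T) (sig P l T) (split P l T) (qData P l T)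
          (exists_realising_qIdeles_pilotDataOfK T.D).choose
          (exists_realising_thetaIdeles_pilotDataOfK T.D).choose
          (exists_realising_qIdeles_pilotDataOfK T.D).choose_spec.1
          (exists_realising_qIdeles_pilotDataOfK T.D).choose_spec.2.1)) (qK P l T)) := by
  have hl₀p : l₀.Prime := by rcases hl₀ with rfl | rfl | rfl <;> norm_num
  have h5 : 5 ≤ l₀ := by rcases hl₀ with rfl | rfl | rfl <;> norm_num
  have hne : 1061 ≠ l₀ := by rcases hl₀ with rfl | rfl | rfl <;> norm_num
  refine not_hSHwBad_of_row frey1061_mem_UP hl₀p h5 frey1061_admitsCore (frey1061_condP2 hl₀) (frey1061_condP5 hl₀p hne) hP6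
    ?_ (frey1061_not_deep hl₀) ?_ M archPk archSub Ψ act Mmod region frobAdm frobLogvol frobΨ frobMmod unitImage ballImage thetaDiv n
    lat sig split qData qK
  · rcases hl₀ with rfl | rfl | rfl
    · exact frey1061_szpiroBad_thirteen
    · exact frey1061_szpiroBad_seventeen
    · exact frey1061_szpiroBad_nineteen
  · intro T
    rcases hl₀ with rfl | rfl | rfl
    · exact GenuineK.not_pilotKummerCompatHull_chosen_triple_1061_thirteen T
    · exact GenuineK.not_pilotKummerCompatHull_chosen_triple_1061_seventeen T
    · exact GenuineK.not_pilotKummerCompatHull_chosen_triple_1061_nineteen T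

end FreyRef

end Summit.ABC.IUTFork.Conditional

end
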